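import Summits.Ventures.PercRepro.C026C028ClusterGluing
import Summits.Ventures.PercRepro.C026C028Gluing

/-!
# C-028(c) composes over a gluing at sure clusters (p6, gen 15)

With `prob_isoMark_clusterGluing` (C026C028ClusterGluing) the four coordinates `Z, Mₐ, M_b, K` of mine-3's
C-028 state multiply over a cluster gluing (`prob_sepAll_clusterGluing` for `Z`), and LEMMA G2 closes as
in `C028At_of_gluing`: **`C028At_of_clusterGluing`** — C-028(c) in `Φ`-form on both parts (read on the
side restrictions of the colourings «colour `s` or surely open», with `Z_s > 0`) gives C-028(c) on
`(G, p)`.  This is the contracted minor of THEOREM T3's K₃-hub: the two copies glued at the sure cluster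
`{v₁ ≡ v₂}`.
-/

namespace PercRepro

namespace MultiGraph

variable {V E : Type*} (G : MultiGraph V E) [Fintype E] [DecidableEq E]

/-! ### Stage 3: the C-028 state multiplies, and C-028 composes over a cluster gluing -/

/-- The all-separated event multiplies over a cluster gluing. -/
theorem prob_sepAll_clusterGluing {p : E → ℝ} (hp : IsProb p) {a b c : V} {side : E → Bool}
    (hg : G.IsClusterGluing p a b c side) :
    prob p {ω | G.IsoMark ω a b c ∧ G.IsoMark ω b a c} =
      prob p {ω | (G.part (sideOrSure p side true) true).IsoMark
          (sideRestrict ω (sideOrSure p side true) true) a b c ∧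
          (G.part (sideOrSure p side true) true).IsoMark
          (sideRestrict ω (sideOrSure p side true) true) b a c} *
        prob p {ω | (G.part (sideOrSure p side false) true).IsoMark
          (sideRestrict ω (sideOrSure p side false) true) a b c ∧
          (G.part (sideOrSure p side false) true).IsoMark
          (sideRestrict ω (sideOrSure p side false) true) b a c} := by
  have hcovA : ∀ w, (w = a ∨ w = b ∨ w = c) → w ≠ a → w = b ∨ w = c := by
    intro w hw hwa
    rcases hw with h | h | h
    · exact absurd h hwa
    · exact Or.inl h
    · exact Or.inr h
  have hcovB : ∀ w, (w = a ∨ w = b ∨ w = c) → w ≠ b → w = a ∨ w = c := by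
    intro w hw hwb
    rcases hw with h | h | h
    · exact Or.inl h
    · exact absurd h hwb
    · exact Or.inr h
  set ET := {ω : Config E | (G.part (sideOrSure p side true) true).IsoMark
    (sideRestrict (forceSure p ω) (sideOrSure p side true) true) a b c ∧
    (G.part (sideOrSure p side true) true).IsoMark
    (sideRestrict (forceSure p ω) (sideOrSure p side true) true) b a c} with hET
  set EF := {ω : Config E | (G.part (sideOrSure p side false) true).IsoMark
    (sideRestrict (forceSure p ω) (sideOrSure p side false) true) a b c ∧
    (G.part (sideOrSure p side false) true).IsoMark
    (sideRestrict (forceSure p ω) (sideOrSure p side false) true) b a c} with hEF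
  have h1 : prob p {ω | G.IsoMark ω a b c ∧ G.IsoMark ω b a c} = prob p (ET ∩ EF) := by
    refine prob_eq_of_eqOn_pos hp fun ω hω => ?_
    have hω' : ∀ e, p e = 1 → ω e = true := fun e he => eq_true_of_weight_pos hω he
    simp only [Set.mem_setOf_eq, Set.mem_inter_iff, hET, hEF, forceSure_eq_of_pos hω]
    rw [G.isoMark_clusterGluing_iff hg hω' (Or.inr (Or.inl rfl)) (Or.inr (Or.inr rfl)) hcovA,
      G.isoMark_clusterGluing_iff hg hω' (Or.inl rfl) (Or.inr (Or.inr rfl)) hcovB]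
    tauto
  have hDT : DependsOn (nonSureSide p side true) ET := by
    rw [hET]
    exact dependsOn_nonSureSide p side true (fun τ =>
      (G.part (sideOrSure p side true) true).IsoMark τ a b c ∧
        (G.part (sideOrSure p side true) true).IsoMark τ b a c)
  have hDF : DependsOn (nonSureSide p side true)ᶜ EF := by
    rw [hEF]
    exact (dependsOn_nonSureSide p side false (fun τ =>
      (G.part (sideOrSure p side false) true).IsoMark τ a b c ∧
        (G.part (sideOrSure p side false) true).IsoMark τ b a c)).mono
      (nonSureSide_false_subset_compl p side)
  have h2 : prob p (ET ∩ EF) = prob p ET * prob p EF := prob_inter_eq_mul_of_dependsOn p hDT hDF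
  have h3 : prob p ET = prob p {ω | (G.part (sideOrSure p side true) true).IsoMark
      (sideRestrict ω (sideOrSure p side true) true) a b c ∧
      (G.part (sideOrSure p side true) true).IsoMark
      (sideRestrict ω (sideOrSure p side true) true) b a c} := by
    refine prob_eq_of_eqOn_pos hp fun ω hω => ?_
    simp only [Set.mem_setOf_eq, hET, forceSure_eq_of_pos hω]
  have h4 : prob p EF = prob p {ω | (G.part (sideOrSure p side false) true).IsoMark
      (sideRestrict ω (sideOrSure p side false) true) a b c ∧
      (G.part (sideOrSure p side false) true).IsoMark
      (sideRestrict ω (sideOrSure p side false) true) b a c} := by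
    refine prob_eq_of_eqOn_pos hp fun ω hω => ?_
    simp only [Set.mem_setOf_eq, hEF, forceSure_eq_of_pos hω]
  rw [h1, h2, h3, h4]

/-- **C-028(c) composes over a cluster gluing**: if both parts satisfy C-028(c) in `Φ`-form (read on the
side restrictions, with `Z_s > 0`), so does `(G, p)`. -/
theorem C028At_of_clusterGluing {p : E → ℝ} (hp : IsProb p) {a b c : V} {side : E → Bool}
    (hg : G.IsClusterGluing p a b c side)
    (hZT : 0 < prob p (G.c028SideSepAll (sideOrSure p side true) true a b c))
    (hZF : 0 < prob p (G.c028SideSepAll (sideOrSure p side false) true a b c))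
    (hT : c028Phi (prob p (G.c028SideSepAll (sideOrSure p side true) true a b c) /
          prob p (G.c028SideIso (sideOrSure p side true) true b a c))
        (prob p (G.c028SideSepAll (sideOrSure p side true) true a b c) /
          prob p (G.c028SideIso (sideOrSure p side true) true a b c)) ≤
      prob p (G.c028SideIso (sideOrSure p side true) true c a b))
    (hF : c028Phi (prob p (G.c028SideSepAll (sideOrSure p side false) true a b c) /
          prob p (G.c028SideIso (sideOrSure p side false) true b a c))
        (prob p (G.c028SideSepAll (sideOrSure p side false) true a b c) /
          prob p (G.c028SideIso (sideOrSure p side false) true a b c)) ≤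
      prob p (G.c028SideIso (sideOrSure p side false) true c a b)) :
    G.C028At p a b c := by
  have hcovA : ∀ w, (w = a ∨ w = b ∨ w = c) → w ≠ a → w = b ∨ w = c := by
    intro w hw hwa
    rcases hw with h | h | h
    · exact absurd h hwa
    · exact Or.inl h
    · exact Or.inr h
  have hcovB : ∀ w, (w = a ∨ w = b ∨ w = c) → w ≠ b → w = a ∨ w = c := by
    intro w hw hwb
    rcases hw with h | h | h
    · exact Or.inl h
    · exact absurd h hwb
    · exact Or.inr h
  have hcovC : ∀ w, (w = a ∨ w = b ∨ w = c) → w ≠ c → w = a ∨ w = b := by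
    intro w hw hwc
    rcases hw with h | h | h
    · exact Or.inl h
    · exact Or.inr h
    · exact absurd h hwc
  have hMa := G.prob_isoMark_clusterGluing hp hg (m := b) (x := a) (y := c) (Or.inl rfl)
    (Or.inr (Or.inr rfl)) hcovB
  have hMb := G.prob_isoMark_clusterGluing hp hg (m := a) (x := b) (y := c) (Or.inr (Or.inl rfl))
    (Or.inr (Or.inr rfl)) hcovA
  have hK := G.prob_isoMark_clusterGluing hp hg (m := c) (x := a) (y := b) (Or.inl rfl)
    (Or.inr (Or.inl rfl)) hcovC
  have hZ := G.prob_sepAll_clusterGluing hp hg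
  rw [← G.law3_four_eq_isoMark] at hZ
  have hZpos : 0 < G.law3 p a b c 4 := by rw [hZ]; exact mul_pos hZT hZF
  rw [G.C028At_iff_phi hp hZpos, G.law3_two_add_four_eq_isoMark, G.law3_three_add_four_eq_isoMark,
    G.law3_one_add_four_eq_isoMark, hMa, hMb, hK, hZ]
  -- the side events are the `c028SideIso` / `c028SideSepAll` of the two colourings
  change c028Phi (prob p (G.c028SideSepAll (sideOrSure p side true) true a b c) *
      prob p (G.c028SideSepAll (sideOrSure p side false) true a b c) /
      (prob p (G.c028SideIso (sideOrSure p side true) true b a c) *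
        prob p (G.c028SideIso (sideOrSure p side false) true b a c)))
    (prob p (G.c028SideSepAll (sideOrSure p side true) true a b c) *
      prob p (G.c028SideSepAll (sideOrSure p side false) true a b c) /
      (prob p (G.c028SideIso (sideOrSure p side true) true a b c) *
        prob p (G.c028SideIso (sideOrSure p side false) true a b c))) ≤
    prob p (G.c028SideIso (sideOrSure p side true) true c a b) *
      prob p (G.c028SideIso (sideOrSure p side false) true c a b)
  have hsubT := G.sideSepAll_subset (sideOrSure p side true) true a b c
  have hsubF := G.sideSepAll_subset (sideOrSure p side false) true a b c
  have hMaT : prob p (G.c028SideSepAll (sideOrSure p side true) true a b c) ≤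
      prob p (G.c028SideIso (sideOrSure p side true) true b a c) := prob_mono hp hsubT.1
  have hMbT : prob p (G.c028SideSepAll (sideOrSure p side true) true a b c) ≤
      prob p (G.c028SideIso (sideOrSure p side true) true a b c) := prob_mono hp hsubT.2
  have hMaF : prob p (G.c028SideSepAll (sideOrSure p side false) true a b c) ≤
      prob p (G.c028SideIso (sideOrSure p side false) true b a c) := prob_mono hp hsubF.1
  have hMbF : prob p (G.c028SideSepAll (sideOrSure p side false) true a b c) ≤
      prob p (G.c028SideIso (sideOrSure p side false) true a b c) := prob_mono hp hsubF.2
  have hMaT0 := lt_of_lt_of_le hZT hMaT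
  have hMbT0 := lt_of_lt_of_le hZT hMbT
  have hMaF0 := lt_of_lt_of_le hZF hMaF
  have hMbF0 := lt_of_lt_of_le hZF hMbF
  rw [← div_mul_div_comm, ← div_mul_div_comm]
  have hKT0 : 0 ≤ prob p (G.c028SideIso (sideOrSure p side true) true c a b) := prob_nonneg hp _
  have hKF0 : 0 ≤ prob p (G.c028SideIso (sideOrSure p side false) true c a b) := prob_nonneg hp _
  have hG2 := c028Phi_mul_le (div_nonneg hZT.le hMaT0.le) ((div_le_one hMaT0).2 hMaT)
    (div_nonneg hZT.le hMbT0.le) ((div_le_one hMbT0).2 hMbT)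
    (div_nonneg hZF.le hMaF0.le) ((div_le_one hMaF0).2 hMaF)
    (div_nonneg hZF.le hMbF0.le) ((div_le_one hMbF0).2 hMbF)
  refine le_trans hG2 (mul_le_mul ?_ ?_ (le_max_right _ _) hKT0)
  · exact max_le hT hKT0
  · exact max_le hF hKF0

end MultiGraph

end PercRepro
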